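import Summits.RiemannHypothesis.RiemannHypothesis.Theorems.OddOneSignedWindows.Negative.OddFoldIncrements
import Literature.NumberTheory.LFunctions.WeilMellinBounds
import HarnessLib

/-!
# `OddOneSignedWindows` (stmt-RiemannHypothesis-17778): the antisymmetric fold RAISES Weil's energy

Negative lemma of the standing disprover (cycle 1) for the crux `OddOneSignedWindows` of route
`OddSector` (rank 2) — part 3 of 3 (parts 1–2: `OddFoldPointwise.lean`, `OddFoldIncrements.lean`,
same directory). The crux: "beyond every height some window `a` carries an odd bottom state of Weil's
form `Re Q`, `Q g = W(g ⋆ g̃)`, that is real and `≥ 0` on `(0, a)`".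

The one mechanism in the tree that PRODUCES one-signed odd bottom states is the antisymmetric
Beurling–Deny fold (`Theorems/OddSectorOddArchAnchor.lean`, item `OddArchAnchor`): replace an odd
test `g` by an odd `h` with `|h(s) − h(x)| ≤ |g(s) − g(x)|`, `|h(x)| ≤ |g(x)|` on the half-line
(`h ≈ sign · |g|`); for the ARCHIMEDEAN energy this never increases the form
(`setIntegral_weilArchDensity_mul_weilIncrement_fold_le`, folded kernel `ρ(|s−x|) − ρ(s+x) ≥ 0`),
so a minimising sequence may be folded into a one-signed one; for the exact sign-fold `h = sign·|g|`
the pole form `−2|∫ g sinh(t/2)|²` does not increase either, so the same mechanism covers the FULL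
form `Re Q` at windows `a ≤ (log 2)/2`, where no prime power enters (`weilPrimeIndex a ⊆ {0, 1}`).

**Theorem (`exists_oddFold_weilQuadratic_lt`).** At EVERY window `a > (log 2)/2` there are
`L²`-normalised smooth odd window tests `g`, `h` with `|h| = |g|` pointwise, `h` real and `≥ 0` on
`(0, ∞)`, `|h(s) − h(x)| ≤ |g(s) − g(x)|` for `x, s > 0` (so `h` is an admissible fold of `g` and its
archimedean energy is `≤` that of `g`), and nevertheless `Re Q(g) < Re Q(h)`.

Hence (`not_oddFoldContraction`) the fold/Beurling–Deny contraction property of `Re Q` in the odd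
sector FAILS at every window beyond `(log 2)/2`: the odd block of Weil's windowed form is NOT a
Markovian (positivity-improving) structure, and no proof of the crux can run through it — the
crux needs unboundedly large windows.

**Mechanism (the obstruction, located).** In the Markov decomposition
`Re Q = P + 𝓔_a − M_a‖·‖²` (`weilQuadratic_re_eq_weilPoleForm_add_weilDirichletEnergy_sub`) take
`g = g₁ − g₂`, `h = g₁ + g₂` with `gᵢ(x) = φᵢ(x) − φᵢ(−x)`, `φ₁` a bump of width `η` at
`τ₀ = (log 2)/2 − d` and `φ₂ = φ₁(log 2 − ·)` its mirror image at `σ₀ = (log 2)/2 + d`, so that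
`τ₀ + σ₀ = log 2`: the pair sits on the ANTIDIAGONAL `x + s = log 2` of the prime-2 REFLECTION.
Then `D_t(h) − D_t(g) = 8 (φ₁ ∗ φ₂)(t) − 8 ∫ φ₁(x) φ₂(x+t) dx` for `t > 0`; at `t = log 2` this is
`+8‖φ₁‖₂² ≥ 8η` (weight `Λ(2)/√2`), while the translation overlap lives at `t ≈ 2d` and costs, against
the archimedean density and the pole form, only `O(η²)`: `Re Q(h) − Re Q(g) ≥ 8η (Λ(2)/√2 − (16 + 8ρ(d)) η) > 0`
for small `η`. In words: the prime REFLECTION atoms `+Λ(n) n^{-1/2} δ(x + s − log n)` of the odd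
block are genuinely positive off-diagonal entries, not dominated by anything.

Numerically (three independent Rayleigh–Ritz engines on this item, `a ≤ 1.3`) the odd bottom state
is nevertheless one-signed in the bulk at every sampled window: the reflection atoms are beaten
there by the SIZE of the archimedean glue and of the theta-like profile, not by structure. Any
proof of the crux must therefore be quantitative in `Λ(n) n^{-1/2}` versus `ρ` — this file shows the
purely structural (Markov/Perron–Frobenius/Jentzsch) road is closed from `a = (log 2)/2` on.

Everything is inline (no new `def`); conclusions are existence of energy-raising folds and the
negation of the contraction property, never a Theses decl. Axioms: propext, Classical.choice,
Quot.sound.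
-/

noncomputable section

open Set MeasureTheory Filter Metric
open scoped Real Topology ComplexConjugate

namespace Summit.RiemannHypothesis.Cruxes.OddOneSignedWindows.Negative

open Literature.NumberTheory.LFunctions
open Summit.RiemannHypothesis.RiemannHypothesis.Theorems.OddArchAnchor
  (setIntegral_weilArchDensity_mul_weilIncrement_fold_le)

/-! ## 1. The energy gap of the antidiagonal pair -/

section PairEnergy

variable {p r₁ r₂ : ℝ → ℝ} {G H : ℝ → ℂ} {τ₀ η : ℝ}
  (hη : 0 < η) (hτ : η < τ₀) (hsep : τ₀ + η < Real.log 2 - τ₀ - η)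
  (hpc : Continuous p) (hp0 : ∀ y, 0 ≤ p y) (hp1 : ∀ y, p y ≤ 1)
  (hps : ∀ y, p y ≠ 0 → τ₀ - η < y ∧ y < τ₀ + η) (hpI : ∫ y, p y ≤ 2 * η)
  (hpI2 : η ≤ ∫ y, p y * p y)
  (hr₁ : ∀ y, r₁ y = p y - p (-y)) (hr₂ : ∀ y, r₂ y = p (Real.log 2 - y) - p (Real.log 2 - -y))
  (hG : IsWeilTest G) (hH : IsWeilTest H)
  (hGr : ∀ x, G x = ((r₁ x - r₂ x : ℝ) : ℂ)) (hHr : ∀ x, H x = ((r₁ x + r₂ x : ℝ) : ℂ))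

include hη hτ hsep hpc hp0 hp1 hps hpI hpI2 hr₁ hr₂ hG hH hGr hHr in
/-- **The energy gap.** `Re Q(H) − Re Q(G) ≥ (16/5) η − 128 η² − 64 ρ(log 2 − 2τ₀ − 2η) η²`:
the prime-2 reflection atom gives `+Λ(2) 2^{-1/2} · 8η ≥ (16/5) η`, every other prime term is
`≥ 0`, the pole form costs `≤ 128 η²`, the archimedean part `≤ 64 ρ(t₁) η²` (`t₁` the left end
of the translation window), and the killing terms cancel (`‖H‖₂ = ‖G‖₂`). [folklore] -/
theorem energy_gap :
    16 / 5 * η - 128 * η ^ 2 - 64 * weilArchDensity (Real.log 2 - 2 * τ₀ - 2 * η) * η ^ 2 ≤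
      (weilQuadratic H).re - (weilQuadratic G).re := by
  obtain ⟨hsG, hsH⟩ := tsupport_GH_subset hη hτ hsep hps hr₁ hr₂ hGr hHr
  set a' : ℝ := Real.log 2 - τ₀ + η with ha'
  rw [weilQuadratic_re_eq_weilPoleForm_add_weilDirichletEnergy_sub hH hsH,
    weilQuadratic_re_eq_weilPoleForm_add_weilDirichletEnergy_sub hG hsG]
  have hnorm : ∫ x, ‖H x‖ ^ 2 = ∫ x, ‖G x‖ ^ 2 :=
    integral_congr_ae (Eventually.of_forall fun x ↦ by
      simp only [norm_H_eq hη hτ hsep hps hr₁ hr₂ hGr hHr x])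
  have hP := neg_le_weilPoleForm_sub hη hτ hsep hpc hp0 hps hpI hr₁ hr₂ hGr hHr
  have hlog2 : 0 < Real.log 2 := Real.log_pos one_lt_two
  -- the prime sum
  have hsum : 16 / 5 * η ≤
      (∑ n ∈ weilPrimeIndex a', (ArithmeticFunction.vonMangoldt n : ℝ) / Real.sqrt n *
          weilIncrement H (Real.log n)) -
        ∑ n ∈ weilPrimeIndex a', (ArithmeticFunction.vonMangoldt n : ℝ) / Real.sqrt n *
          weilIncrement G (Real.log n) := by
    rw [← Finset.sum_sub_distrib]
    have hterm : ∀ n ∈ weilPrimeIndex a',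
        0 ≤ (ArithmeticFunction.vonMangoldt n : ℝ) / Real.sqrt n * weilIncrement H (Real.log n) -
          (ArithmeticFunction.vonMangoldt n : ℝ) / Real.sqrt n * weilIncrement G (Real.log n) := by
      intro n _
      rw [← mul_sub]
      refine mul_nonneg (div_nonneg ArithmeticFunction.vonMangoldt_nonneg (Real.sqrt_nonneg _)) ?_
      rcases Nat.lt_or_ge n 2 with hn | hn
      · have h0 : Real.log n = 0 := by
          interval_cases n <;> simp
        rw [h0]
        simp [weilIncrement]
      · have hn' : (2 : ℝ) ≤ n := by exact_mod_cast hn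
        have hlogn : Real.log 2 ≤ Real.log n := Real.log_le_log two_pos hn'
        exact weilIncrement_sub_nonneg hη hτ hsep hp0 hps hr₁ hr₂ hG hH hGr hHr
          (by linarith) (fun hI ↦ by have := hI.2; linarith)
    have h2mem : 2 ∈ weilPrimeIndex a' := by
      rw [mem_weilPrimeIndex]
      push_cast
      linarith
    have h2 := Finset.single_le_sum hterm h2mem
    have hw := two_fifths_le_vonMangoldt_two_div
    have hD := le_weilIncrement_sub_log_two hη hτ hsep hpc hps hpI2 hr₁ hr₂ hG hH hGr hHr
    have h3 : (2 / 5 : ℝ) * (8 * η) ≤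
        (ArithmeticFunction.vonMangoldt 2 : ℝ) / Real.sqrt 2 * weilIncrement H (Real.log 2) -
          (ArithmeticFunction.vonMangoldt 2 : ℝ) / Real.sqrt 2 * weilIncrement G (Real.log 2) := by
      rw [← mul_sub]
      exact mul_le_mul hw hD (by linarith) (le_trans (by norm_num) hw)
    push_cast at h2
    linarith
  -- the archimedean part
  have harch : -(64 * weilArchDensity (Real.log 2 - 2 * τ₀ - 2 * η) * η ^ 2) ≤
      (∫ t in Ioi (0 : ℝ), weilArchDensity t * weilIncrement H t) -
        ∫ t in Ioi (0 : ℝ), weilArchDensity t * weilIncrement G t := by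
    have hiH := integrableOn_weilArchDensity_mul_weilIncrement hH
    have hiG := integrableOn_weilArchDensity_mul_weilIncrement hG
    rw [← integral_sub hiH hiG]
    have ht₁ : 0 < Real.log 2 - 2 * τ₀ - 2 * η := by linarith
    set c : ℝ := -(16 * η * weilArchDensity (Real.log 2 - 2 * τ₀ - 2 * η)) with hc
    have hρ₁ : 0 < weilArchDensity (Real.log 2 - 2 * τ₀ - 2 * η) := weilArchDensity_pos ht₁
    have hc0 : c ≤ 0 := by rw [hc]; nlinarith
    have hlow : IntegrableOn (fun t ↦ (Icc (Real.log 2 - 2 * τ₀ - 2 * η)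
        (Real.log 2 - 2 * τ₀ + 2 * η)).indicator (fun _ ↦ c) t) (Ioi 0) :=
      ((integrableOn_const (by simp)).integrable_indicator measurableSet_Icc).integrableOn
    have hmono := setIntegral_mono_on hlow (hiH.sub hiG) measurableSet_Ioi fun t ht ↦ (by
      change _ ≤ weilArchDensity t * weilIncrement H t - weilArchDensity t * weilIncrement G t
      have ht' : 0 < t := ht
      have hρ0 : 0 ≤ weilArchDensity t := (weilArchDensity_pos ht').le
      by_cases htI : t ∈ Ioo (Real.log 2 - 2 * τ₀ - 2 * η) (Real.log 2 - 2 * τ₀ + 2 * η)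
      · rw [indicator_of_mem (Ioo_subset_Icc_self htI), hc, ← mul_sub]
        have hρ : weilArchDensity t ≤ weilArchDensity (Real.log 2 - 2 * τ₀ - 2 * η) :=
          weilArchDensity_antitoneOn (mem_Ioi.2 ht₁) (mem_Ioi.2 ht') htI.1.le
        have hD := neg_le_weilIncrement_sub hη hτ hsep hpc hp0 hp1 hps hpI hr₁ hr₂ hG hH hGr hHr ht'
        nlinarith [mul_nonneg hρ0 (by linarith : 0 ≤ weilIncrement H t - weilIncrement G t + 16 * η),
          mul_le_mul_of_nonneg_left hρ (by linarith : (0 : ℝ) ≤ 16 * η)]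
      · have hD0 := weilIncrement_sub_nonneg hη hτ hsep hp0 hps hr₁ hr₂ hG hH hGr hHr ht' htI
        have h1 : (Icc (Real.log 2 - 2 * τ₀ - 2 * η) (Real.log 2 - 2 * τ₀ + 2 * η)).indicator
            (fun _ ↦ c) t ≤ 0 := by
          simp only [Set.indicator_apply]
          split_ifs <;> linarith
        rw [← mul_sub]
        nlinarith [mul_nonneg hρ0 hD0])
    have hval : ∫ t in Ioi (0 : ℝ), (Icc (Real.log 2 - 2 * τ₀ - 2 * η)
        (Real.log 2 - 2 * τ₀ + 2 * η)).indicator (fun _ ↦ c) t = 4 * η * c := by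
      rw [integral_indicator_const _ measurableSet_Icc, measureReal_restrict_apply measurableSet_Icc,
        inter_eq_left.2 (fun t ht ↦ mem_Ioi.2 (lt_of_lt_of_le ht₁ ht.1)),
        Real.volume_real_Icc_of_le (by linarith), smul_eq_mul]
      ring
    rw [hval, hc] at hmono
    simp only [Pi.sub_apply] at hmono
    nlinarith
  have hE : 16 / 5 * η - 64 * weilArchDensity (Real.log 2 - 2 * τ₀ - 2 * η) * η ^ 2 ≤
      weilDirichletEnergy a' H - weilDirichletEnergy a' G := by
    unfold weilDirichletEnergy
    linarith
  rw [hnorm]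
  linarith

end PairEnergy

/-! ## 2. The fold raises the energy: main theorem and corollaries -/


/-- **The antisymmetric fold raises Weil's energy at every window `a > (log 2)/2`.** There are
smooth odd window tests `g`, `h` supported in `[-a, a]`, both `L²`-normalised, with `|h x| = |g x|`
for all `x`, `h` real-valued and `≥ 0` on `(0, ∞)`, `|h s − h x| ≤ |g s − g x|` for `x, s > 0`
(`h` is an admissible antisymmetric fold of `g`: its archimedean energy is at most that of `g`,
`setIntegral_weilArchDensity_mul_weilIncrement_fold_le`), and `Re Q(g) < Re Q(h)`.
Witness: `g = c(g₁ − g₂)`, `h = c(g₁ + g₂)`, `gᵢ = φᵢ − φᵢ(−·)`, `φ₁` a bump at `(log 2)/2 − d`,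
`φ₂ = φ₁(log 2 − ·)`; the prime-2 reflection atom contributes `+8 Λ(2) 2^{-1/2} ‖φ₁‖₂²` to
`Re Q(h) − Re Q(g)`, everything else `O(‖φ₁‖₁²)`. [folklore] -/
theorem exists_oddFold_weilQuadratic_lt {a : ℝ} (ha : Real.log 2 / 2 < a) :
    ∃ g h : ℝ → ℂ, IsWeilTest g ∧ IsWeilTest h ∧
      tsupport g ⊆ Icc (-a) a ∧ tsupport h ⊆ Icc (-a) a ∧
      (∀ x, g (-x) = -g x) ∧ (∀ x, h (-x) = -h x) ∧
      ∫ x, ‖g x‖ ^ 2 = (1 : ℝ) ∧ ∫ x, ‖h x‖ ^ 2 = (1 : ℝ) ∧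
      (∀ x, ‖h x‖ = ‖g x‖) ∧
      (∀ x s, 0 < x → 0 < s → ‖h s - h x‖ ≤ ‖g s - g x‖) ∧
      (∀ x, 0 < x → (h x).im = 0 ∧ 0 ≤ (h x).re) ∧
      (∫ t in Ioi (0 : ℝ), weilArchDensity t * weilIncrement h t) ≤
        (∫ t in Ioi (0 : ℝ), weilArchDensity t * weilIncrement g t) ∧
      (weilQuadratic g).re < (weilQuadratic h).re := by
  -- parameters
  have hlog2 : 0 < Real.log 2 := Real.log_pos one_lt_two
  set d : ℝ := min ((a - Real.log 2 / 2) / 2) (Real.log 2 / 8) with hd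
  have hd0 : 0 < d := lt_min (by linarith) (by linarith)
  have hd1 : d ≤ (a - Real.log 2 / 2) / 2 := min_le_left _ _
  have hd2 : d ≤ Real.log 2 / 8 := min_le_right _ _
  have hρd : 0 < weilArchDensity d := weilArchDensity_pos hd0
  set η : ℝ := min (d / 2) (1 / (80 + 40 * weilArchDensity d)) with hηdef
  have hη0 : 0 < η := lt_min (by linarith) (by positivity)
  have hη1 : η ≤ d / 2 := min_le_left _ _
  have hη2 : η ≤ 1 / (80 + 40 * weilArchDensity d) := min_le_right _ _
  set τ₀ : ℝ := Real.log 2 / 2 - d with hτ₀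
  have hτ : η < τ₀ := by linarith
  have hsep : τ₀ + η < Real.log 2 - τ₀ - η := by linarith
  -- the bump and the pair
  let φ : ContDiffBump τ₀ := ⟨η / 2, η, by linarith, by linarith⟩
  have hIn : φ.rIn = η / 2 := rfl
  have hOut : φ.rOut = η := rfl
  set p : ℝ → ℝ := fun y ↦ φ y with hp
  have hpc : Continuous p := φ.continuous
  have hpd : ContDiff ℝ ((⊤ : ℕ∞) : WithTop ℕ∞) p := φ.contDiff
  have hp0 : ∀ y, 0 ≤ p y := fun y ↦ φ.nonneg
  have hp1 : ∀ y, p y ≤ 1 := fun y ↦ φ.le_one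
  have hps : ∀ y, p y ≠ 0 → τ₀ - η < y ∧ y < τ₀ + η := fun y hy ↦ bump_support φ hOut hy
  have hpI : ∫ y, p y ≤ 2 * η := integral_bump_le φ hOut hη0
  have hpI2 : η ≤ ∫ y, p y * p y := le_integral_bump_sq φ hIn hη0
  set r₁ : ℝ → ℝ := fun y ↦ p y - p (-y) with hr₁def
  set r₂ : ℝ → ℝ := fun y ↦ p (Real.log 2 - y) - p (Real.log 2 - -y) with hr₂def
  have hr₁ : ∀ y, r₁ y = p y - p (-y) := fun y ↦ rfl
  have hr₂ : ∀ y, r₂ y = p (Real.log 2 - y) - p (Real.log 2 - -y) := fun y ↦ rfl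
  set G : ℝ → ℂ := fun x ↦ ((r₁ x - r₂ x : ℝ) : ℂ) with hGdef
  set H : ℝ → ℂ := fun x ↦ ((r₁ x + r₂ x : ℝ) : ℂ) with hHdef
  have hGr : ∀ x, G x = ((r₁ x - r₂ x : ℝ) : ℂ) := fun x ↦ rfl
  have hHr : ∀ x, H x = ((r₁ x + r₂ x : ℝ) : ℂ) := fun x ↦ rfl
  -- test functions
  have hr₁d : ContDiff ℝ ((⊤ : ℕ∞) : WithTop ℕ∞) r₁ := hpd.sub (hpd.comp contDiff_neg)
  have hr₂d : ContDiff ℝ ((⊤ : ℕ∞) : WithTop ℕ∞) r₂ :=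
    (hpd.comp (contDiff_const.sub contDiff_id)).sub (hpd.comp (contDiff_const.sub contDiff_neg))
  obtain ⟨hGc, hHc⟩ := hasCompactSupport_GH hη0 hτ hsep hps hr₁ hr₂ hGr hHr
  have hGt : IsWeilTest G := ⟨Complex.ofRealCLM.contDiff.comp (hr₁d.sub hr₂d), hGc⟩
  have hHt : IsWeilTest H := ⟨Complex.ofRealCLM.contDiff.comp (hr₁d.add hr₂d), hHc⟩
  obtain ⟨hsG, hsH⟩ := tsupport_GH_subset hη0 hτ hsep hps hr₁ hr₂ hGr hHr
  have hwin : Icc (-(Real.log 2 - τ₀ + η)) (Real.log 2 - τ₀ + η) ⊆ Icc (-a) a :=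
    Icc_subset_Icc (by linarith) (by linarith)
  -- the energy gap
  have hgap := energy_gap hη0 hτ hsep hpc hp0 hp1 hps hpI hpI2 hr₁ hr₂ hGt hHt hGr hHr
  have hρle : weilArchDensity (Real.log 2 - 2 * τ₀ - 2 * η) ≤ weilArchDensity d :=
    weilArchDensity_antitoneOn (mem_Ioi.2 hd0) (mem_Ioi.2 (by linarith)) (by linarith)
  have hη3 : (80 + 40 * weilArchDensity d) * η ≤ 1 := by
    have := hη2
    rw [le_div_iff₀ (by positivity)] at this
    linarith
  have hlt : (weilQuadratic G).re < (weilQuadratic H).re := by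
    have h1 : 64 * weilArchDensity (Real.log 2 - 2 * τ₀ - 2 * η) * η ^ 2 ≤
        64 * weilArchDensity d * η ^ 2 := by
      have := mul_le_mul_of_nonneg_right hρle (sq_nonneg η)
      linarith
    have h2 : (128 + 64 * weilArchDensity d) * η * η ≤ 8 / 5 * η := by
      have := mul_le_mul_of_nonneg_right hη3 hη0.le
      nlinarith
    nlinarith
  -- normalisation
  set N : ℝ := ∫ x, ‖G x‖ ^ 2 with hN
  have hnormHG : ∫ x, ‖H x‖ ^ 2 = N :=
    integral_congr_ae (Eventually.of_forall fun x ↦ by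
      simp only [norm_H_eq hη0 hτ hsep hps hr₁ hr₂ hGr hHr x])
  have hN0 : 0 ≤ N := integral_nonneg fun x ↦ by positivity
  have hNne : N ≠ 0 := by
    intro h0
    have hG0 := hGt.eq_zero_of_integral_norm_sq_eq_zero h0
    have h1 : p τ₀ = 1 := bump_eq_one φ hIn (by rw [sub_self, abs_zero]; linarith)
    have h2 : p (-τ₀) = 0 := by
      by_contra h
      have b := hps _ h
      linarith [b.1]
    have h3 : p (Real.log 2 - τ₀) = 0 := by
      by_contra h
      have b := hps _ h
      linarith [b.2]
    have h4 : p (Real.log 2 - -τ₀) = 0 := by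
      by_contra h
      have b := hps _ h
      linarith [b.2]
    have hval : G τ₀ = 1 := by
      rw [hGr, hr₁, hr₂, h1, h2, h3, h4]
      simp
    have : G τ₀ = 0 := by rw [hG0]; rfl
    rw [hval] at this
    exact one_ne_zero this
  have hNpos : 0 < N := lt_of_le_of_ne hN0 (Ne.symm hNne)
  set c : ℝ := (Real.sqrt N)⁻¹ with hcdef
  have hcpos : 0 < c := inv_pos.2 (Real.sqrt_pos.2 hNpos)
  have hc2 : c ^ 2 * N = 1 := by
    rw [hcdef, inv_pow, Real.sq_sqrt hNpos.le, inv_mul_cancel₀ hNne]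
  have hnsq : ∀ (F : ℝ → ℂ) (x : ℝ), ‖(c : ℂ) * F x‖ ^ 2 = c ^ 2 * ‖F x‖ ^ 2 := fun F x ↦ by
    rw [norm_mul, mul_pow, Complex.norm_real, Real.norm_of_nonneg hcpos.le]
  refine ⟨fun x ↦ (c : ℂ) * G x, fun x ↦ (c : ℂ) * H x, hGt.const_mul _, hHt.const_mul _,
    tsupport_mul_subset_right.trans (hsG.trans hwin), tsupport_mul_subset_right.trans (hsH.trans hwin),
    fun x ↦ ?_, fun x ↦ ?_, ?_, ?_, fun x ↦ ?_, fun x s hx hs ↦ ?_, fun x hx ↦ ?_, ?_, ?_⟩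
  · beta_reduce
    rw [G_odd hr₁ hr₂ hGr x, mul_neg]
  · beta_reduce
    rw [H_odd hr₁ hr₂ hHr x, mul_neg]
  · simp_rw [hnsq]
    rw [integral_const_mul]
    exact hc2
  · simp_rw [hnsq]
    rw [integral_const_mul, hnormHG]
    exact hc2
  · rw [norm_mul, norm_mul, norm_H_eq hη0 hτ hsep hps hr₁ hr₂ hGr hHr x]
  · rw [← mul_sub, ← mul_sub, norm_mul, norm_mul]
    exact mul_le_mul_of_nonneg_left (norm_H_sub_le hη0 hτ hsep hp0 hps hr₁ hr₂ hGr hHr hx hs)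
      (norm_nonneg _)
  · obtain ⟨him, hre⟩ := H_sign hη0 hτ hsep hp0 hps hr₁ hr₂ hHr hx
    rw [Complex.im_ofReal_mul, Complex.re_ofReal_mul, him, mul_zero]
    exact ⟨rfl, mul_nonneg hcpos.le hre⟩
  · refine setIntegral_weilArchDensity_mul_weilIncrement_fold_le (hGt.const_mul _) (hHt.const_mul _)
      (fun x ↦ by rw [G_odd hr₁ hr₂ hGr x, mul_neg]) (fun x ↦ by rw [H_odd hr₁ hr₂ hHr x, mul_neg])
      (fun x s hx hs ↦ ?_) (fun x _ ↦ le_of_eq ?_)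
    · rw [← mul_sub, ← mul_sub, norm_mul, norm_mul]
      exact mul_le_mul_of_nonneg_left (norm_H_sub_le hη0 hτ hsep hp0 hps hr₁ hr₂ hGr hHr hx hs)
        (norm_nonneg _)
    · rw [norm_mul, norm_mul, norm_H_eq hη0 hτ hsep hps hr₁ hr₂ hGr hHr x]
  · rw [weilQuadratic_const_mul, weilQuadratic_const_mul, Complex.normSq_ofReal,
      Complex.re_ofReal_mul, Complex.re_ofReal_mul]
    exact mul_lt_mul_of_pos_left hlt (mul_pos hcpos hcpos)

/-- **The odd-sector fold/Beurling–Deny contraction property FAILS at every window beyond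
`(log 2)/2`.** It is NOT true that for all smooth odd window tests `g`, `h` on `[-a, a]` with
`|h(s) − h(x)| ≤ |g(s) − g(x)|` (`x, s > 0`) and `|h| = |g|` one has `Re Q(h) ≤ Re Q(g)` — the
exact hypothesis shape of the folded-kernel inequality
`setIntegral_weilArchDensity_mul_weilIncrement_fold_le` that proves item `OddArchAnchor`. So the
mechanism that yields one-signed odd bottom states for the archimedean form (and for the full form
at windows `a ≤ (log 2)/2`) cannot produce them at ANY window `a > (log 2)/2`, let alone on the
unbounded window set the crux `OddOneSignedWindows` asks for. [folklore] -/
theorem not_oddFoldContraction {a : ℝ} (ha : Real.log 2 / 2 < a) :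
    ¬ ∀ g h : ℝ → ℂ, IsWeilTest g → IsWeilTest h →
        tsupport g ⊆ Icc (-a) a → tsupport h ⊆ Icc (-a) a →
        (∀ x, g (-x) = -g x) → (∀ x, h (-x) = -h x) →
        (∀ x s, 0 < x → 0 < s → ‖h s - h x‖ ≤ ‖g s - g x‖) → (∀ x, ‖h x‖ = ‖g x‖) →
        (weilQuadratic h).re ≤ (weilQuadratic g).re := by
  intro hall
  obtain ⟨g, h, hg, hh, hsg, hsh, hgo, hho, -, -, heq, hdom, -, -, hlt⟩ :=
    exists_oddFold_weilQuadratic_lt ha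
  exact absurd (hall g h hg hh hsg hsh hgo hho hdom heq) (not_le.2 hlt)

/-- **Nor does normalisation or one-signedness of the fold help**: even among `L²`-NORMALISED odd
window tests, a fold `h` that is real and `≥ 0` on `(0, ∞)` (the shape of a one-signed odd bottom
state) can have STRICTLY LARGER energy than the sign-changing `g` it came from. In particular
"replace a sign-changing odd minimiser by its positive fold" is not an energy-non-increasing
operation for Weil's form once a prime reflection `x + s = log n` crosses the window. [folklore] -/
theorem exists_normalised_oneSigned_fold_energy_gt {a : ℝ} (ha : Real.log 2 / 2 < a) :
    ∃ g h : ℝ → ℂ, IsWeilTest g ∧ IsWeilTest h ∧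
      tsupport g ⊆ Icc (-a) a ∧ tsupport h ⊆ Icc (-a) a ∧
      (∀ x, g (-x) = -g x) ∧ (∀ x, h (-x) = -h x) ∧
      ∫ x, ‖g x‖ ^ 2 = (1 : ℝ) ∧ ∫ x, ‖h x‖ ^ 2 = (1 : ℝ) ∧
      (∀ x, ‖h x‖ = ‖g x‖) ∧ (∀ x, 0 < x → (h x).im = 0 ∧ 0 ≤ (h x).re) ∧
      (weilQuadratic g).re < (weilQuadratic h).re := by
  obtain ⟨g, h, hg, hh, hsg, hsh, hgo, hho, hng, hnh, heq, -, hsign, -, hlt⟩ :=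
    exists_oddFold_weilQuadratic_lt ha
  exact ⟨g, h, hg, hh, hsg, hsh, hgo, hho, hng, hnh, heq, hsign, hlt⟩

end Summit.RiemannHypothesis.Cruxes.OddOneSignedWindows.Negative

end
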